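import Summits.SmoothPoincare4.SmoothPoincare4.Theses.EntropyLadder
import Literature.Topology.FourManifolds.ThetaFour

/-!
# Line `birth` — BC3 skeleton for the crux `ThinEmbeddingExists` (stmt-SmoothPoincare4-3719)

Route `EntropyLadder` (route-SmoothPoincare4-EntropyLadder, crux E, rank 4), skeleton registrar
planner-skel-stmt-SmoothPoincare4-3719-0, 2026-08-17.

The crux (`Summit.SmoothPoincare4.SmoothPoincare4.Theses.EntropyLadder.ThinEmbeddingExists`, E of the
thesis X = E ∧ G ∧ T): every homotopy 4-sphere `M` (bare summit shape: Hausdorff, second countable,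
charted on `ℝ⁴`, `C^∞`, `M ≃ₕ S⁴`) admits a smooth embedding `ι : M → ℝ⁵` whose (unnormalised,
`μH[4]`) Colding–Minicozzi entropy is below that of the self-shrinking cylinder `S¹(√2)×ℝ³`
(`ent(range ι) < ent(Cyl₁)`, `λ(S¹×ℝ³) = √(2π/e) ≈ 1.5203`).

## The line = the route's own two-layer plan for E, with the topological half cut at the 3-handles

Route header (TWO-LAYER PLAN / item E): "E ⇐ B → S2 → E is already filed as support glue"; "an
analytic proof of E would have to come from … a direct construction from a contractible 3-handlebody
bounding Σ (exists by Θ₄ = 0 + trading) that removes the 3-handles". Typed, that is three stubs: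

* `stub_boundsContractibleThreeHandlebody` (KNOWN — a theorem of 1963–65 vintage; size XL as Lean
  debt, nil as research). Every homotopy 4-sphere `M` bounds a compact contractible smooth 5-manifold
  `W` carrying a Morse function adapted to `∂W` all of whose critical points have index `≤ 3`
  (`Bounds₃(M)` in the route's unfolded `IsHandlebodyOfIndexLE 4 3` shape). In print: `Θ₄ = 0`
  (Kervaire–Milnor 1963, table p. 504 via Thm. 5.1 and Lemma 2.3; tree NAMED FACT
  `Literature.Topology.FourManifolds.isHCobordant_sphere_of_homotopySphere_four`: `M` is smoothly
  h-cobordant to `S⁴`), cap the `S⁴` end of the h-cobordism with `B⁵` to get a compact contractible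
  `W` with `∂W = M`; take any adapted Morse function (Milnor 1965, Thm. 2.5) and cancel/trade the
  critical points of index 5 and 4 (= indices 0 and 1 of `1 - f`, the decomposition built on
  `∂W = M`): index 0 by connectedness (Milnor 1965, Thm. 8.1), index 1 traded for index 3 using
  `π₁(M) = π₁(W) = 1` and `dim W = 5` (Milnor 1965, §8; Kosinski 1993, VIII.3). No Whitney trick
  is needed for these two steps.
* `stub_threeHandleRemoval` (OPEN — the load-bearing stub, SPC4-hard exactly as the crux is).
  If a homotopy 4-sphere `M` bounds a compact contractible 5-dimensional 3-handlebody then it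
  bounds a compact contractible 5-dimensional 2-handlebody (`Bounds₃(M) → Bounds₂(M)`), i.e. `M` is a
  presentation sphere `∂H⁵(P, ε)`. This is the 2/3-cancellation across the 4-dimensional middle
  level of `W`: `H₂(W) = H₃(W) = 0` makes the 3-handles cancel the surplus 2-handles ALGEBRAICALLY
  (unimodular incidence matrix), and the missing step is to make attaching 2-spheres of the
  3-handles meet belt 2-spheres of 2-handles geometrically once inside a 4-manifold — the Whitney
  move that fails smoothly in dimension 4 (route header BARRIERS: HCobordismBarrierFour "applies
  in spirit to E"). Together with stub 1 it is exactly the route's support item B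
  (`BoundsContractibleTwoHandlebody`, stmt-SmoothPoincare4-3720): `boundsTwoHandlebody_of` below.
  Why plausibly true: it is implied by SPC4 (`S⁴ = ∂B⁵`, index `0` only) and holds for every KNOWN
  homotopy 4-sphere (all known constructions — Gluck twists, Cappell–Shaneson spheres, ∂ of
  AC-presentation thickenings — are presentation spheres or standard). Why it might fail: an
  exotic non-presentation 4-sphere.
* `stub_thinHandlebodyEmbedding` (a GMT construction, size L; VERBATIM the route's support item S2
  `ThinHandlebodyEmbedding`, stmt-SmoothPoincare4-3721, so the item and this stub close together:
  `sig_stub_thinHandlebodyEmbedding_iff`). If `M` bounds a compact contractible 5-dimensional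
  2-handlebody then `M` embeds in `ℝ⁵` with `ent < ent(S¹(√2)×ℝ³)`: re-embed `W ⊂ ℝ⁵` as a δ-thin
  regular neighbourhood of its 2-spine with cone-flared junctions; the local Gaussian-density
  models are `S⁴`, `S³×ℝ`, `S²×ℝ²` (`λ ≤ 4/e ≈ 1.4715`) and junctions `(1 + O(ε))`, below
  `λ(S¹×ℝ³) ≈ 1.5203` (Stone 1994; Colding–Minicozzi 2012; Bernstein–Wang 2018).

`ThinEmbeddingExists_of : Sig.stub_boundsContractibleThreeHandlebody → Sig.stub_threeHandleRemoval →
Sig.stub_thinHandlebodyEmbedding → ThinEmbeddingExists` is the REAL composition (sorry-free, pure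
logic): given `M` and `e : M ≃ₕ S⁴`, stub 1 gives a contractible 3-handlebody filling, stub 2 trades
it for a 2-handlebody filling, stub 3 thins that filling inside `ℝ⁵` to a Gaussian-thin embedding.
`ThinEmbeddingExists_proof : ThinEmbeddingExists` wires the three sorried stubs into it (it depends on
`sorryAx` only through the stubs). Also recorded, sorry-free: stubs 1 + 2 give the route item B by
name (`boundsTwoHandlebody_of`), and B + stub 3 give the crux (`ThinEmbeddingExists_of_B_S2`, the
route's filed support glue E ⇐ B → S2 → E, now kernel-checked against the route file).

## Disproof used / dead lines / negatives

`ledger crux ls stmt-SmoothPoincare4-3719`: no workfiles (no `Disproof.lean`, no `_false_without_`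
theorem, no `Theorems/ThinEmbeddingExists/Negative/*`, no earlier line) at registration
(2026-08-17); `ledger negatives --problem SmoothPoincare4`: 0 refuted statements. Nothing to honour
or avoid yet. Item evidence (refuter 2026-08-15, grounder g18-7): E is satisfiable for the round
`S⁴` (`λ(S⁴) = 1.4436 < 1.5203`, same normalisation both sides), implied by SPC4, and `E ⟺ B` by the
route's glue — this skeleton makes the `B → E` direction and the cut of B at the 3-handles explicit.
No stub is an instance of a landed Negative lemma (there are none).

## BC3 audit (this seat; raw outputs in the seat's NOTES.md `birth-certificate:`)

`lean check --json` rc 0, errors [], `sorry` exactly in `stub_boundsContractibleThreeHandlebody`,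
`stub_threeHandleRemoval`, `stub_thinHandlebodyEmbedding` (sorry count 3 = stub count, zero
elsewhere; `ThinEmbeddingExists_of` axioms = [propext, Classical.choice, Quot.sound]). Probes (seat
folder `bc/ThinEmbeddingExists_stub_probes{A,B,C}.lean`, `maxHeartbeats 400000`): for each of the
three stubs S, `S → ThinEmbeddingExists` and `S → SmoothPoincare4` by `first | exact? | simpa | aesop`
FAIL 6/6 (unsolved goals after exhaustive aesop search); by
`first | exact? | simpa [S, goal] | (unfold S goal; simpa) | aesop` FAIL 6/6 (stub 1: all alternatives
fail; stubs 2, 3: heartbeat timeouts inside the chain, so every alternative was re-run alone at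
1 000 000 heartbeats in probe C — `exact?` "could not close the goal", `simpa […]` / `unfold; simpa`
"assumption failed", `aesop` "failed after exhaustive search": 10/10 fail). No stub is cheaply the
crux or the summit.
-/

set_option linter.dupNamespace false
set_option linter.unusedVariables false

noncomputable section

namespace Summit.SmoothPoincare4.SmoothPoincare4.Cruxes.ThinEmbeddingExists.Birth

open scoped Manifold ContDiff Topology MeasureTheory ContinuousMap ENNReal
open Set Function MeasureTheory
open Summit.SmoothPoincare4.SmoothPoincare4.Theses.EntropyLadder

/-! ### Stub signatures (`Sig.stub_*`; the registered stubs below restate them verbatim so that the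
registered signatures are self-contained over tree declarations) -/

/-- STUB 1 SIGNATURE — every homotopy 4-sphere bounds a compact contractible smooth 5-manifold with
an adapted Morse function of index `≤ 3` (`Θ₄ = 0` + capping + trading of the index-4/5 critical
points). -/
def Sig.stub_boundsContractibleThreeHandlebody : Prop :=
  ∀ (M : Type) [TopologicalSpace M] [T2Space M] [SecondCountableTopology M]
    [ChartedSpace (EuclideanSpace ℝ (Fin 4)) M] [IsManifold (𝓡 4) ∞ M],
    M ≃ₕ Metric.sphere (0 : EuclideanSpace ℝ (Fin 5)) 1 →
      ∃ (W : Type) (_ : TopologicalSpace W) (_ : T2Space W) (_ : SecondCountableTopology W)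
        (_ : ChartedSpace (EuclideanHalfSpace (4 + 1)) W) (_ : IsManifold (𝓡∂ (4 + 1)) ∞ W)
        (_ : CompactSpace W),
        ContractibleSpace W ∧
          (∃ f : W → ℝ, Literature.Topology.FourManifolds.IsMorseAdapted (𝓡∂ (4 + 1)) f ∧
            ∀ z, Literature.Topology.FourManifolds.IsMCriticalPt (𝓡∂ (4 + 1)) f z →
              Literature.Topology.FourManifolds.morseIndex (𝓡∂ (4 + 1)) f z ≤ 3) ∧
          ∃ φ : M → W, Manifold.IsSmoothEmbedding (𝓡 4) (𝓡∂ (4 + 1)) ∞ φ ∧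
            Set.range φ = (𝓡∂ (4 + 1)).boundary W

/-- STUB 2 SIGNATURE — 3-HANDLE REMOVAL: a homotopy 4-sphere bounding a compact contractible
5-dimensional 3-handlebody bounds a compact contractible 5-dimensional 2-handlebody. -/
def Sig.stub_threeHandleRemoval : Prop :=
  ∀ (M : Type) [TopologicalSpace M] [T2Space M] [SecondCountableTopology M]
    [ChartedSpace (EuclideanSpace ℝ (Fin 4)) M] [IsManifold (𝓡 4) ∞ M],
    M ≃ₕ Metric.sphere (0 : EuclideanSpace ℝ (Fin 5)) 1 →
      (∃ (W : Type) (_ : TopologicalSpace W) (_ : T2Space W) (_ : SecondCountableTopology W)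
        (_ : ChartedSpace (EuclideanHalfSpace (4 + 1)) W) (_ : IsManifold (𝓡∂ (4 + 1)) ∞ W)
        (_ : CompactSpace W),
        ContractibleSpace W ∧
          (∃ f : W → ℝ, Literature.Topology.FourManifolds.IsMorseAdapted (𝓡∂ (4 + 1)) f ∧
            ∀ z, Literature.Topology.FourManifolds.IsMCriticalPt (𝓡∂ (4 + 1)) f z →
              Literature.Topology.FourManifolds.morseIndex (𝓡∂ (4 + 1)) f z ≤ 3) ∧
          ∃ φ : M → W, Manifold.IsSmoothEmbedding (𝓡 4) (𝓡∂ (4 + 1)) ∞ φ ∧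
            Set.range φ = (𝓡∂ (4 + 1)).boundary W) →
      ∃ (W : Type) (_ : TopologicalSpace W) (_ : T2Space W) (_ : SecondCountableTopology W)
        (_ : ChartedSpace (EuclideanHalfSpace (4 + 1)) W) (_ : IsManifold (𝓡∂ (4 + 1)) ∞ W)
        (_ : CompactSpace W),
        ContractibleSpace W ∧
          (∃ f : W → ℝ, Literature.Topology.FourManifolds.IsMorseAdapted (𝓡∂ (4 + 1)) f ∧
            ∀ z, Literature.Topology.FourManifolds.IsMCriticalPt (𝓡∂ (4 + 1)) f z →
              Literature.Topology.FourManifolds.morseIndex (𝓡∂ (4 + 1)) f z ≤ 2) ∧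
          ∃ φ : M → W, Manifold.IsSmoothEmbedding (𝓡 4) (𝓡∂ (4 + 1)) ∞ φ ∧
            Set.range φ = (𝓡∂ (4 + 1)).boundary W

/-- STUB 3 SIGNATURE — THIN HANDLEBODY EMBEDDING = the route's support item `ThinHandlebodyEmbedding`
verbatim (stmt-SmoothPoincare4-3721). -/
def Sig.stub_thinHandlebodyEmbedding : Prop :=
  ∀ (M : Type) [TopologicalSpace M] [T2Space M] [SecondCountableTopology M]
    [ChartedSpace (EuclideanSpace ℝ (Fin 4)) M] [IsManifold (𝓡 4) ∞ M],
    (∃ (W : Type) (_ : TopologicalSpace W) (_ : T2Space W) (_ : SecondCountableTopology W)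
        (_ : ChartedSpace (EuclideanHalfSpace (4 + 1)) W) (_ : IsManifold (𝓡∂ (4 + 1)) ∞ W)
        (_ : CompactSpace W),
        ContractibleSpace W ∧
          (∃ f : W → ℝ, Literature.Topology.FourManifolds.IsMorseAdapted (𝓡∂ (4 + 1)) f ∧
            ∀ z, Literature.Topology.FourManifolds.IsMCriticalPt (𝓡∂ (4 + 1)) f z →
              Literature.Topology.FourManifolds.morseIndex (𝓡∂ (4 + 1)) f z ≤ 2) ∧
          ∃ φ : M → W, Manifold.IsSmoothEmbedding (𝓡 4) (𝓡∂ (4 + 1)) ∞ φ ∧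
            Set.range φ = (𝓡∂ (4 + 1)).boundary W) →
      ∃ ι : M → EuclideanSpace ℝ (Fin 5), Manifold.IsSmoothEmbedding (𝓡 4) (𝓡 5) ∞ ι ∧
        (⨆ (p : EuclideanSpace ℝ (Fin 5)) (t : ℝ) (_ : 0 < t), (ENNReal.ofReal (t ^ 2))⁻¹ *
            ∫⁻ x in Set.range ι, ENNReal.ofReal (Real.exp (-(‖x - p‖ ^ 2) / (4 * t))) ∂μH[4]) <
          (⨆ (p : EuclideanSpace ℝ (Fin 5)) (t : ℝ) (_ : 0 < t), (ENNReal.ofReal (t ^ 2))⁻¹ *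
            ∫⁻ x in {y : EuclideanSpace ℝ (Fin 5) | y 0 ^ 2 + y 1 ^ 2 = 2},
              ENNReal.ofReal (Real.exp (-(‖x - p‖ ^ 2) / (4 * t))) ∂μH[4])

/-! ### Registered stubs (the ONLY `sorry`s of the file) -/

/-- **Stub 1 — every homotopy 4-sphere bounds a compact contractible 5-dimensional 3-handlebody**
(KNOWN; Lean debt XL). Why true: `Θ₄ = 0` — `M` is smoothly h-cobordant to `S⁴`
(tree named fact `Literature.Topology.FourManifolds.isHCobordant_sphere_of_homotopySphere_four`;
Kervaire–Milnor 1963, table p. 504, via Thm. 5.1 p. 512 and Lemma 2.3 p. 506); capping the `S⁴` end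
with `B⁵` gives a compact contractible `W`, `∂W = M`; an adapted Morse function exists (Milnor 1965,
Thm. 2.5) and its critical points of index 5 and 4 are removed by 0-handle cancellation and
1 ↔ 3 trading in the decomposition built on `M` (`π₁(M) = π₁(W) = 1`, `dim W = 5`; Milnor 1965,
Thm. 8.1 and §8; Kosinski 1993, VIII.3) — no Whitney trick at these indices.
Sources: KervaireMilnorAnnals1963, Milnor1965 (h-cobordism lectures), Kosinski1993, Wall1964. -/
theorem stub_boundsContractibleThreeHandlebody :
    ∀ (M : Type) [TopologicalSpace M] [T2Space M] [SecondCountableTopology M]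
      [ChartedSpace (EuclideanSpace ℝ (Fin 4)) M] [IsManifold (𝓡 4) ∞ M],
      M ≃ₕ Metric.sphere (0 : EuclideanSpace ℝ (Fin 5)) 1 →
        ∃ (W : Type) (_ : TopologicalSpace W) (_ : T2Space W) (_ : SecondCountableTopology W)
          (_ : ChartedSpace (EuclideanHalfSpace (4 + 1)) W) (_ : IsManifold (𝓡∂ (4 + 1)) ∞ W)
          (_ : CompactSpace W),
          ContractibleSpace W ∧
            (∃ f : W → ℝ, Literature.Topology.FourManifolds.IsMorseAdapted (𝓡∂ (4 + 1)) f ∧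
              ∀ z, Literature.Topology.FourManifolds.IsMCriticalPt (𝓡∂ (4 + 1)) f z →
                Literature.Topology.FourManifolds.morseIndex (𝓡∂ (4 + 1)) f z ≤ 3) ∧
            ∃ φ : M → W, Manifold.IsSmoothEmbedding (𝓡 4) (𝓡∂ (4 + 1)) ∞ φ ∧
              Set.range φ = (𝓡∂ (4 + 1)).boundary W := by
  sorry

/-- **Stub 2 — 3-handle removal** (OPEN, load-bearing, hardest; SPC4-hard like the crux). A homotopy
4-sphere bounding a compact contractible 5-dimensional 3-handlebody bounds a compact contractible
5-dimensional 2-handlebody (is a presentation sphere `∂H⁵(P, ε)`). Content: cancel the 3-handles of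
`W` against surplus 2-handles across the 4-dimensional middle level — algebraically forced by
`H₂(W) = H₃(W) = 0`, geometrically the Whitney move that fails smoothly in dimension 4
(HCobordismBarrierFour, "in spirit"); any proof must either find the Whitney discs in this special
situation (the level 4-manifold is `∂(0-handle ∪ 2-handles) = #k S²×S²`-like after sliding) or change
`W`. Why plausibly true: implied by SPC4; true for every known homotopy 4-sphere. Why it might
fail: an exotic non-presentation sphere. With stub 1 it is the route item B
(`BoundsContractibleTwoHandlebody`, stmt-SmoothPoincare4-3720) — `boundsTwoHandlebody_of`.
Sources: KervaireMilnorAnnals1963, Milnor1965, AndrewsCurtis1965, Gompf1991Killing,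
DonaldsonIrrationality1987 (why the Whitney step is not formal). -/
theorem stub_threeHandleRemoval :
    ∀ (M : Type) [TopologicalSpace M] [T2Space M] [SecondCountableTopology M]
      [ChartedSpace (EuclideanSpace ℝ (Fin 4)) M] [IsManifold (𝓡 4) ∞ M],
      M ≃ₕ Metric.sphere (0 : EuclideanSpace ℝ (Fin 5)) 1 →
        (∃ (W : Type) (_ : TopologicalSpace W) (_ : T2Space W) (_ : SecondCountableTopology W)
          (_ : ChartedSpace (EuclideanHalfSpace (4 + 1)) W) (_ : IsManifold (𝓡∂ (4 + 1)) ∞ W)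
          (_ : CompactSpace W),
          ContractibleSpace W ∧
            (∃ f : W → ℝ, Literature.Topology.FourManifolds.IsMorseAdapted (𝓡∂ (4 + 1)) f ∧
              ∀ z, Literature.Topology.FourManifolds.IsMCriticalPt (𝓡∂ (4 + 1)) f z →
                Literature.Topology.FourManifolds.morseIndex (𝓡∂ (4 + 1)) f z ≤ 3) ∧
            ∃ φ : M → W, Manifold.IsSmoothEmbedding (𝓡 4) (𝓡∂ (4 + 1)) ∞ φ ∧
              Set.range φ = (𝓡∂ (4 + 1)).boundary W) →
        ∃ (W : Type) (_ : TopologicalSpace W) (_ : T2Space W) (_ : SecondCountableTopology W)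
          (_ : ChartedSpace (EuclideanHalfSpace (4 + 1)) W) (_ : IsManifold (𝓡∂ (4 + 1)) ∞ W)
          (_ : CompactSpace W),
          ContractibleSpace W ∧
            (∃ f : W → ℝ, Literature.Topology.FourManifolds.IsMorseAdapted (𝓡∂ (4 + 1)) f ∧
              ∀ z, Literature.Topology.FourManifolds.IsMCriticalPt (𝓡∂ (4 + 1)) f z →
                Literature.Topology.FourManifolds.morseIndex (𝓡∂ (4 + 1)) f z ≤ 2) ∧
            ∃ φ : M → W, Manifold.IsSmoothEmbedding (𝓡 4) (𝓡∂ (4 + 1)) ∞ φ ∧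
              Set.range φ = (𝓡∂ (4 + 1)).boundary W := by
  sorry

/-- **Stub 3 — thin handlebody embedding** (= the route's support item `ThinHandlebodyEmbedding`,
stmt-SmoothPoincare4-3721, verbatim; a GMT construction, size L). If `M` bounds a compact contractible
5-dimensional 2-handlebody `W` then `M` embeds in `ℝ⁵` with `ent(range) < ent(S¹(√2)×ℝ³)`: `W ⊂ ℝ⁵`
(`W × I ≅ B⁶`), re-embed `W` as a δ-thin neighbourhood of its 2-spine with cone-flared junctions
(`δ₂ ≪ δ₁ ≪ 1`, half-angle `ε`); local Gaussian-density models `S⁴`, `S³×ℝ`, `S²×ℝ²`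
(`λ ≤ 4/e ≈ 1.4715`), junction factors `1 + O(ε)`, so `λ(∂W_δ) < λ(S¹×ℝ³) ≈ 1.5203`; and
`∂W_δ ≅ M`. Why it might fail: a 2-handle junction costing `≥ λ(S¹) − λ(S²) ≈ 0.049` in every
embedding (route KILL CRITERIA (ii)). Sources: Stone1994, ColdingMinicozzi2012, BernsteinWang2018,
ChodoshMantoulidisSchulze2025. -/
theorem stub_thinHandlebodyEmbedding :
    ∀ (M : Type) [TopologicalSpace M] [T2Space M] [SecondCountableTopology M]
      [ChartedSpace (EuclideanSpace ℝ (Fin 4)) M] [IsManifold (𝓡 4) ∞ M],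
      (∃ (W : Type) (_ : TopologicalSpace W) (_ : T2Space W) (_ : SecondCountableTopology W)
          (_ : ChartedSpace (EuclideanHalfSpace (4 + 1)) W) (_ : IsManifold (𝓡∂ (4 + 1)) ∞ W)
          (_ : CompactSpace W),
          ContractibleSpace W ∧
            (∃ f : W → ℝ, Literature.Topology.FourManifolds.IsMorseAdapted (𝓡∂ (4 + 1)) f ∧
              ∀ z, Literature.Topology.FourManifolds.IsMCriticalPt (𝓡∂ (4 + 1)) f z →
                Literature.Topology.FourManifolds.morseIndex (𝓡∂ (4 + 1)) f z ≤ 2) ∧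
            ∃ φ : M → W, Manifold.IsSmoothEmbedding (𝓡 4) (𝓡∂ (4 + 1)) ∞ φ ∧
              Set.range φ = (𝓡∂ (4 + 1)).boundary W) →
        ∃ ι : M → EuclideanSpace ℝ (Fin 5), Manifold.IsSmoothEmbedding (𝓡 4) (𝓡 5) ∞ ι ∧
          (⨆ (p : EuclideanSpace ℝ (Fin 5)) (t : ℝ) (_ : 0 < t), (ENNReal.ofReal (t ^ 2))⁻¹ *
              ∫⁻ x in Set.range ι, ENNReal.ofReal (Real.exp (-(‖x - p‖ ^ 2) / (4 * t))) ∂μH[4]) <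
            (⨆ (p : EuclideanSpace ℝ (Fin 5)) (t : ℝ) (_ : 0 < t), (ENNReal.ofReal (t ^ 2))⁻¹ *
              ∫⁻ x in {y : EuclideanSpace ℝ (Fin 5) | y 0 ^ 2 + y 1 ^ 2 = 2},
                ENNReal.ofReal (Real.exp (-(‖x - p‖ ^ 2) / (4 * t))) ∂μH[4]) := by
  sorry

/-! ### Sorry-free bookkeeping: how the stubs sit against the route's items -/

/-- Stub 3's signature is, up to unfolding, the route decl `ThinHandlebodyEmbedding` (so the route
item stmt-SmoothPoincare4-3721 and this stub close together). [bookkeeping] -/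
theorem sig_stub_thinHandlebodyEmbedding_iff :
    Sig.stub_thinHandlebodyEmbedding ↔ ThinHandlebodyEmbedding := Iff.rfl

/-- Stubs 1 + 2 give the route's support item B = `BoundsContractibleTwoHandlebody`
(stmt-SmoothPoincare4-3720) BY NAME (sorry-free composition). [bookkeeping] -/
theorem boundsTwoHandlebody_of :
    Sig.stub_boundsContractibleThreeHandlebody → Sig.stub_threeHandleRemoval →
      BoundsContractibleTwoHandlebody := by
  intro h₃ hR M _ _ _ _ _ e
  exact hR M e (h₃ M e)

/-- The route's filed support glue `B → S2 → E`, kernel-checked against the route file: the items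
`BoundsContractibleTwoHandlebody` and `ThinHandlebodyEmbedding` give the crux BY NAME. [bookkeeping] -/
theorem ThinEmbeddingExists_of_B_S2 :
    BoundsContractibleTwoHandlebody → ThinHandlebodyEmbedding → ThinEmbeddingExists := by
  intro hB hS M _ _ _ _ _ e
  exact hS M (hB M e)

/-! ### Composition: the three stubs prove the crux BY NAME -/

/-- **The line closes the crux modulo the three registered stubs** (sorry-free, pure logic over the
stub signatures): fill `M` by a contractible 3-handlebody (stub 1), remove its 3-handles (stub 2),
thin the resulting 2-handlebody inside `ℝ⁵` below the `S¹×ℝ³` entropy (stub 3). [bookkeeping] -/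
theorem ThinEmbeddingExists_of :
    Sig.stub_boundsContractibleThreeHandlebody → Sig.stub_threeHandleRemoval →
      Sig.stub_thinHandlebodyEmbedding → ThinEmbeddingExists := by
  intro h₃ hR hS M _ _ _ _ _ e
  exact hS M (hR M e (h₃ M e))

/-- The skeleton in its final shape: the crux BY NAME from the three registered stubs (it becomes
the crux proof when the last `stub_*` is discharged; until then it depends on `sorryAx` through the
stubs only — no `sorry` of its own). [bookkeeping] -/
theorem ThinEmbeddingExists_proof : ThinEmbeddingExists :=
  ThinEmbeddingExists_of stub_boundsContractibleThreeHandlebody stub_threeHandleRemoval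
    stub_thinHandlebodyEmbedding

end Summit.SmoothPoincare4.SmoothPoincare4.Cruxes.ThinEmbeddingExists.Birth

end
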